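/-
Copyright (c) 2026. All rights reserved.
Released under Apache 2.0 license as described in the file LICENSE.
-/
import Summits.ValiantsHypothesis.ValiantsHypothesis.Theorems.IsolationRoundsFree
import HarnessLib

/-!
# Isolation rounds with free edges, II: acyclic free graphs

`IsolationRoundsFree` (O-L2-19) runs the succinct FGT isolation rounds of S4b with UNLABELED edges
of weight `0` («free edges») under the hypothesis `hfree` that every first index carries at most
one free position (column-sparse).  The hypothesis is used at ONE place: a short cycle of the
admissible graph has a LABELLED support entry, so that its restricted label pattern is non-zero and
the oracle can destroy it.  This file carries the method to its natural ceiling — FREE CYCLES: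
* §1 CYCLE TRANSFER (`exists_isCycle_transfer`): every edge of a cycle of `relGraph G` is a support
  entry `±1` of its dart matrix, so a cycle whose support entries all satisfy `G'` transfers
  (Mathlib `SimpleGraph.Walk.transfer`) to a cycle of `relGraph G'` of the same length.
* §2 ACYCLIC FREE GRAPH ⇒ hash-family membership (`labPat_walkSum_mem_famPatR_forest`): if the
  free positions of `G₀` form an acyclic bipartite graph, a cycle cannot have only free support
  entries (it would transfer to the free graph), so some support entry is labelled and — the
  labelling being read-once on labelled positions — the restricted pattern is `±1` there.
* §3 The three wrappers of `IsolationRoundsFree` in ABSTRACT form, once and for all: one round,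
  `t` rounds, and the isolated survivor, from the MEMBERSHIP PROPERTY `hmem` («restricted patterns
  of short cycles of every `G ⊆ G₀` lie in the hash family») in place of `(hlab, hfree)`; proofs
  verbatim those of `IsolationRoundsFree`.
* §4 `exists_isolating_rounds_forest`: the free-edge isolation theorem under `hlab` + ACYCLIC free
  graph (conclusion verbatim that of `exists_isolating_rounds_free`).
An all-free cycle has zero pattern under every weight, so free cycles are exactly what the method
cannot destroy (dense constants: GT17's regime).
Currency: kernel-certified helper for the W4 isolation road (O-L2-20); closes no item; no data
defs, no facts/doors. [cite: FennerGurjarThierauf2016, Section 3] (free-edge variant).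
-/

set_option linter.dupNamespace false

namespace Summit.ValiantsHypothesis.ValiantsHypothesis.Theorems.IsolationRoundsForest

open SimpleGraph Summit.ValiantsHypothesis.ValiantsHypothesis.Theorems.ShortCyclePatterns
  Summit.ValiantsHypothesis.ValiantsHypothesis.Theorems.RelationGraphCycles
  Summit.ValiantsHypothesis.ValiantsHypothesis.Theorems.IsolationRoundStep
  Summit.ValiantsHypothesis.ValiantsHypothesis.Theorems.IsolationRounds
  Summit.ValiantsHypothesis.ValiantsHypothesis.Theorems.IsolationRoundsFree

variable {M : Type*} [Fintype M] [DecidableEq M] {r : ℕ}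

/-! ### §1 Cycle transfer between relation graphs -/

/-- CYCLE TRANSFER: every edge of a cycle `c` of `relGraph G` is a support entry (`±1`) of its dart
matrix, so if all support entries satisfy `G'`, `c` transfers to a cycle of `relGraph G'` of the
same length. [folklore] -/
theorem exists_isCycle_transfer {α β : Type*} [DecidableEq α] [DecidableEq β]
    {G G' : α → β → Prop} {u : α ⊕ β} {c : (relGraph G).Walk u u} (hc : c.IsCycle)
    (h : ∀ a b, walkSum dartMat c a b ≠ 0 → G' a b) :
    ∃ c' : (relGraph G').Walk u u, c'.IsCycle ∧ c'.length = c.length := by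
  have htrail : c.IsTrail := hc.isCircuit.isTrail
  have hedges : ∀ e, e ∈ c.edges → e ∈ (relGraph G').edgeSet := by
    intro e he
    obtain ⟨d, hd, rfl⟩ := List.mem_map.1 he
    obtain ⟨a, b, -, hor⟩ := relGraph_adj_iff.1 d.adj
    have hedge : d.edge = s(Sum.inl a, Sum.inr b) := by
      show s(d.fst, d.snd) = _
      rcases hor with ⟨h₁, h₂⟩ | ⟨h₁, h₂⟩
      · rw [h₁, h₂]
      · rw [h₁, h₂, Sym2.eq_swap]
    have hval : dartMat d.fst d.snd a b = 1 ∨ dartMat d.fst d.snd a b = -1 := by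
      rcases hor with ⟨h₁, h₂⟩ | ⟨h₁, h₂⟩
      · exact Or.inl (by simp [h₁, h₂])
      · exact Or.inr (by simp [h₁, h₂])
    have he' : ∀ x y, (relGraph G).Adj x y → Matrix.entryAddMonoidHom ℤ a b (dartMat x y) ≠ 0 →
        s(x, y) = s(Sum.inl a, Sum.inr b) :=
      fun x y hxy hne => (rel_of_dartMat_apply_ne_zero hxy (by simpa using hne)).2.1
    have h1 := (map_walkSum_of_isTrail (Matrix.entryAddMonoidHom ℤ a b) dartMat he' htrail).2
      d hd hedge
    simp only [Matrix.entryAddMonoidHom_apply] at h1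
    have hne : walkSum dartMat c a b ≠ 0 := by
      rw [h1]
      rcases hval with hv | hv <;> rw [hv] <;> decide
    rw [hedge, SimpleGraph.mem_edgeSet, relGraph_adj_inl_inr]
    exact h a b hne
  exact ⟨c.transfer (relGraph G') hedges, hc.transfer hedges, c.length_transfer hedges⟩

/-! ### §2 Acyclic free graph ⇒ hash-family membership -/

/-- KEY (acyclic version of `IsolationRoundsFree.labPat_walkSum_mem_famPatR`): under a partial
labelling of `G₀` that is read-once on its labelled positions and whose FREE positions form an
ACYCLIC bipartite graph, the restricted label pattern of every cycle of `relGraph G` (`G ⊆ G₀` of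
girth `> 2L`) of length `≤ 4L` belongs to the hash family — in particular it is NON-ZERO: a cycle
with only free support entries would transfer to a cycle of the free graph. [this file] -/
theorem labPat_walkSum_mem_famPatR_forest {G₀ G : Fin r → Fin r → Prop}
    {lab : Fin r → Fin r → Option M}
    (hlab : ∀ i j i' j' μ, G₀ i j → G₀ i' j' → lab i j = some μ → lab i' j' = some μ →
      i = i' ∧ j = j')
    (hforest : ∀ (u : Fin r ⊕ Fin r) (c : (relGraph fun i j => G₀ i j ∧ lab i j = none).Walk u u),
      ¬ c.IsCycle)
    (hGG₀ : ∀ i j, G i j → G₀ i j) {L : ℕ}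
    (hg : ∀ (u : Fin r ⊕ Fin r) (c : (relGraph G).Walk u u), c.IsCycle → 2 * L < c.length)
    {u : Fin r ⊕ Fin r} {c : (relGraph G).Walk u u} (hc : c.IsCycle) (hl : c.length ≤ 4 * L) :
    (fun μ => labPat lab (walkSum dartMat c) (some μ)) ∈ famPatR G lab L := by
  have hsupp : ∀ i j, walkSum dartMat c i j ≠ 0 → G₀ i j :=
    fun i j h => hGG₀ i j (rel_of_walkSum_dartMat_ne_zero c h)
  have htrail : c.IsTrail := hc.isCircuit.isTrail
  unfold famPatR
  refine Finset.mem_filter.2 ⟨Finset.mem_image_of_mem _ (walkSum_mem_shortCycleFamily hg hc hl),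
    fun h0 => ?_, fun μ => ?_⟩
  · -- some support entry is labelled — else the cycle transfers to the (acyclic) free graph …
    obtain ⟨i, j, μ, hμ, hij⟩ : ∃ i j μ, lab i j = some μ ∧ walkSum dartMat c i j ≠ 0 := by
      by_contra! hnone
      have hfr : ∀ i j, walkSum dartMat c i j ≠ 0 → G₀ i j ∧ lab i j = none := by
        intro i j hij
        refine ⟨hsupp i j hij, ?_⟩
        cases hl' : lab i j with
        | none => rfl
        | some μ => exact absurd (hnone i j μ hl') hij
      obtain ⟨c', hc', -⟩ :=
        exists_isCycle_transfer (G' := fun i j => G₀ i j ∧ lab i j = none) hc hfr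
      exact hforest u c' hc'
    -- … and the pattern at its label is the entry itself (read-once on labelled positions)
    have h2 : labPat lab (walkSum dartMat c) (some μ) = 0 := by simpa using congr_fun h0 μ
    rw [labPat_some_apply hlab hsupp hμ hij] at h2
    exact hij h2
  · show (labPat lab (walkSum dartMat c) (some μ)).natAbs ≤ 1
    by_cases h : ∃ i j, lab i j = some μ ∧ walkSum dartMat c i j ≠ 0
    · obtain ⟨i, j, hμ, hij⟩ := h
      rw [labPat_some_apply hlab hsupp hμ hij]
      exact natAbs_walkSum_dartMat_le htrail i j
    · push Not at h
      rw [labPat_eq_zero h]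
      simp

/-! ### §3 Rounds from the membership property (abstract form of `IsolationRoundsFree` §§3–4) -/

/-- ONE ROUND from the MEMBERSHIP PROPERTY `hmem` (restricted patterns of short cycles of every
`G ⊆ G₀` lie in the hash family) and the ORACLE of S4b-i: for `G ⊆ G₀` of girth `> 2L` some good
`w` makes the minimum face under `labWt lab (fun o => o.elim 0 w)` have girth `> 4L`.
[cite: FennerGurjarThierauf2016, Lemmas 3.2–3.5] (free-edge variant, abstract form) -/
theorem exists_round_of_mem {G₀ G : Fin r → Fin r → Prop} {lab : Fin r → Fin r → Option M}
    {Good : (M → ℕ) → Prop} {ℓ : ℕ}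
    (hmem : ∀ G' : Fin r → Fin r → Prop, (∀ i j, G' i j → G₀ i j) → ∀ L : ℕ,
      (∀ (u : Fin r ⊕ Fin r) (c : (relGraph G').Walk u u), c.IsCycle → 2 * L < c.length) →
      ∀ (u : Fin r ⊕ Fin r) (c : (relGraph G').Walk u u), c.IsCycle → c.length ≤ 4 * L →
        (fun μ => labPat lab (walkSum dartMat c) (some μ)) ∈ famPatR G' lab L)
    (horacle : ∀ S : Finset (M → ℤ), S.card ≤ (r + r) ^ 4 → (∀ π ∈ S, π ≠ 0) →
      (∀ π ∈ S, ∀ μ, (π μ).natAbs ≤ 1) →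
      ∃ w : M → ℕ, Good w ∧ (∀ μ, w μ < 2 ^ ℓ) ∧ ∀ π ∈ S, ∑ μ, π μ * (w μ : ℤ) ≠ 0)
    (hGG₀ : ∀ i j, G i j → G₀ i j) {L : ℕ}
    (hg : ∀ (u : Fin r ⊕ Fin r) (c : (relGraph G).Walk u u), c.IsCycle → 2 * L < c.length) :
    ∃ w : M → ℕ, Good w ∧ (∀ μ, w μ < 2 ^ ℓ) ∧
      ∀ (u : Fin r ⊕ Fin r) (c : (relGraph (nextRel G (labWt lab fun o => o.elim 0 w))).Walk u u),
        c.IsCycle → 4 * L < c.length := by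
  obtain ⟨w, hgood, hlt, hS⟩ := horacle (famPatR G lab L) (card_famPatR_le G lab L)
    (fun π hπ => ne_zero_of_mem_famPatR hπ) (fun π hπ => natAbs_le_of_mem_famPatR hπ)
  refine ⟨w, hgood, hlt, girth_nextRel (labWt lab fun o => o.elim 0 w) fun u c hc hl => ?_⟩
  have key : ∑ μ, labPat lab (walkSum dartMat c) (some μ) * (w μ : ℤ) ≠ 0 :=
    hS _ (hmem G hGG₀ L hg u c hc hl)
  rw [sum_labPat_some_mul] at key
  simpa only [labWt_apply] using key

/-- `t` rounds from the membership property push the girth bound to `2 · 2 ^ t`. -/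
theorem exists_rounds_girth_of_mem {G₀ : Fin r → Fin r → Prop} {lab : Fin r → Fin r → Option M}
    {Good : (M → ℕ) → Prop} {ℓ : ℕ}
    (hmem : ∀ G' : Fin r → Fin r → Prop, (∀ i j, G' i j → G₀ i j) → ∀ L : ℕ,
      (∀ (u : Fin r ⊕ Fin r) (c : (relGraph G').Walk u u), c.IsCycle → 2 * L < c.length) →
      ∀ (u : Fin r ⊕ Fin r) (c : (relGraph G').Walk u u), c.IsCycle → c.length ≤ 4 * L →
        (fun μ => labPat lab (walkSum dartMat c) (some μ)) ∈ famPatR G' lab L)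
    (horacle : ∀ S : Finset (M → ℤ), S.card ≤ (r + r) ^ 4 → (∀ π ∈ S, π ≠ 0) →
      (∀ π ∈ S, ∀ μ, (π μ).natAbs ≤ 1) →
      ∃ w : M → ℕ, Good w ∧ (∀ μ, w μ < 2 ^ ℓ) ∧ ∀ π ∈ S, ∑ μ, π μ * (w μ : ℤ) ≠ 0) :
    ∀ t : ℕ, ∃ ws : List (Option M → ℕ), ws.length = t ∧
      (∀ w' ∈ ws, ∃ w : M → ℕ, Good w ∧ (∀ μ, w μ < 2 ^ ℓ) ∧ w' = fun o => o.elim 0 w) ∧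
      ∀ (u : Fin r ⊕ Fin r) (c : (relGraph (rounds lab G₀ ws)).Walk u u), c.IsCycle →
        2 * 2 ^ t < c.length
  | 0 => ⟨[], rfl, fun _ hw => absurd hw List.not_mem_nil, fun u c hc => by
      have h3 := hc.three_le_length
      rw [pow_zero, mul_one]
      omega⟩
  | t + 1 => by
    obtain ⟨ws, hlen, hws, hg⟩ := exists_rounds_girth_of_mem hmem horacle t
    have hGG₀ : ∀ i j, rounds lab G₀ ws i j → G₀ i j := fun i j h => rounds_le lab ws h
    obtain ⟨w, hgood, hlt, hg'⟩ := exists_round_of_mem hmem horacle hGG₀ hg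
    refine ⟨ws ++ [fun o => o.elim 0 w],
      by rw [List.length_append, List.length_singleton, hlen], fun w' hw' => ?_, ?_⟩
    · rw [List.mem_append, List.mem_singleton] at hw'
      rcases hw' with hw' | rfl
      · exact hws w' hw'
      · exact ⟨w, hgood, hlt, rfl⟩
    · rw [rounds_append]
      intro u c hc
      have h := hg' u c hc
      rw [pow_succ]
      omega

/-- SUCCINCT ISOLATION ROUNDS WITH FREE EDGES from the MEMBERSHIP PROPERTY (abstract form of
`IsolationRoundsFree.exists_isolating_rounds_free`; same conclusion): `T ≤ log₂ r + 1` good weight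
vectors and a `G₀`-admissible `σ` whose combined weight, charged on labelled positions only, is
strictly below that of every other `G₀`-admissible permutation.
[cite: FennerGurjarThierauf2016, Section 3] (free-edge variant, abstract form) -/
theorem exists_isolating_rounds_of_mem {G₀ : Fin r → Fin r → Prop}
    {lab : Fin r → Fin r → Option M} {Good : (M → ℕ) → Prop} {ℓ : ℕ}
    (hmem : ∀ G' : Fin r → Fin r → Prop, (∀ i j, G' i j → G₀ i j) → ∀ L : ℕ,
      (∀ (u : Fin r ⊕ Fin r) (c : (relGraph G').Walk u u), c.IsCycle → 2 * L < c.length) →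
      ∀ (u : Fin r ⊕ Fin r) (c : (relGraph G').Walk u u), c.IsCycle → c.length ≤ 4 * L →
        (fun μ => labPat lab (walkSum dartMat c) (some μ)) ∈ famPatR G' lab L)
    (horacle : ∀ S : Finset (M → ℤ), S.card ≤ (r + r) ^ 4 → (∀ π ∈ S, π ≠ 0) →
      (∀ π ∈ S, ∀ μ, (π μ).natAbs ≤ 1) →
      ∃ w : M → ℕ, Good w ∧ (∀ μ, w μ < 2 ^ ℓ) ∧ ∀ π ∈ S, ∑ μ, π μ * (w μ : ℤ) ≠ 0)
    (hadm : ∃ σ : Equiv.Perm (Fin r), ∀ k, G₀ k (σ k)) :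
    ∃ (T : ℕ) (ws : Fin T → M → ℕ), T ≤ Nat.log 2 r + 1 ∧ (∀ t, Good (ws t)) ∧
      (∀ t μ, ws t μ < 2 ^ ℓ) ∧ ∃ σ : Equiv.Perm (Fin r), (∀ k, G₀ k (σ k)) ∧
        ∀ B : ℕ, r * 2 ^ ℓ ≤ 2 ^ B → ∀ τ : Equiv.Perm (Fin r), (∀ k, G₀ k (τ k)) → τ ≠ σ →
          ∑ k, ∑ t, (lab k (σ k)).elim 0 (ws t) * 2 ^ (B * (T - 1 - ↑t)) <
            ∑ k, ∑ t, (lab k (τ k)).elim 0 (ws t) * 2 ^ (B * (T - 1 - ↑t)) := by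
  obtain ⟨ws, hlen, hws, hg⟩ := exists_rounds_girth_of_mem hmem horacle (Nat.log 2 r + 1)
  -- after `log₂ r + 1` rounds the admissible graph is acyclic: at most one survivor
  have hnoc : ∀ (u : Fin r ⊕ Fin r) (c : (relGraph (rounds lab G₀ ws)).Walk u u),
      ¬ c.IsCycle := by
    intro u c hc
    have h1 := hg u c hc
    have h2 := length_le_card_of_isCycle hc
    rw [Fintype.card_sum, Fintype.card_fin] at h2
    have h3 : r < 2 ^ (Nat.log 2 r + 1) := Nat.lt_pow_succ_log_self (by decide) r
    omega
  obtain ⟨σ₀, hσ₀⟩ := hadm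
  obtain ⟨σ, hσ⟩ := exists_adm_rounds lab ws hσ₀
  have hws' : ∀ t : Fin ws.length, ∃ w : M → ℕ, Good w ∧ (∀ μ, w μ < 2 ^ ℓ) ∧
      ws.get t = fun o => o.elim 0 w := fun t => hws _ (List.get_mem ws t)
  choose wv hgood hlt hwv using hws'
  refine ⟨ws.length, wv, hlen.le, hgood, hlt, σ, fun k => rounds_le lab ws (hσ k),
    fun B hB τ hτ hne => ?_⟩
  have hτn : ¬ ∀ k, rounds lab G₀ ws k (τ k) := fun hτ' =>
    hne (perm_unique_of_forall_not_isCycle _ hnoc hτ' hσ)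
  -- digits are carry-free: each round weight of `σ` is `< r · 2 ^ ℓ ≤ 2 ^ B`
  have hdig : ∀ w' ∈ ws, ∑ k, w' (lab k (σ k)) < 2 ^ B := by
    intro w' hw'
    obtain ⟨w, -, hwlt, rfl⟩ := hws w' hw'
    rcases Nat.eq_zero_or_pos r with hr | hr
    · subst hr
      simp only [Finset.univ_eq_empty, Finset.sum_empty]
      exact Nat.two_pow_pos B
    · calc ∑ k, (fun o : Option M => o.elim 0 w) (lab k (σ k)) < ∑ _k : Fin r, 2 ^ ℓ :=
            Finset.sum_lt_sum_of_nonempty ⟨⟨0, hr⟩, Finset.mem_univ _⟩ fun k _ =>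
              elim_lt_two_pow w hwlt (lab k (σ k))
        _ = r * 2 ^ ℓ := by
            rw [Finset.sum_const, Finset.card_univ, Fintype.card_fin, smul_eq_mul]
        _ ≤ 2 ^ B := hB
  have key := lexVal_lt_of_not_adm lab ws hσ hτ hτn hdig
  rw [← sum_sum_get_mul_eq_lexVal lab ws σ B, ← sum_sum_get_mul_eq_lexVal lab ws τ B] at key
  simpa only [hwv] using key

/-! ### §4 The isolation theorem for acyclic free graphs -/

/-- SUCCINCT ISOLATION ROUNDS WITH FREE EDGES, ACYCLIC VERSION: as
`IsolationRoundsFree.exists_isolating_rounds_free` (same conclusion), with the column-sparse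
hypothesis `hfree` replaced by «the FREE positions of `G₀` (those with `lab = none`) form an
ACYCLIC bipartite graph». [cite: FennerGurjarThierauf2016, Section 3] (free-edge variant) -/
theorem exists_isolating_rounds_forest {G₀ : Fin r → Fin r → Prop}
    {lab : Fin r → Fin r → Option M} {Good : (M → ℕ) → Prop} {ℓ : ℕ}
    (hlab : ∀ i j i' j' μ, G₀ i j → G₀ i' j' → lab i j = some μ → lab i' j' = some μ →
      i = i' ∧ j = j')
    (hforest : ∀ (u : Fin r ⊕ Fin r) (c : (relGraph fun i j => G₀ i j ∧ lab i j = none).Walk u u),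
      ¬ c.IsCycle)
    (horacle : ∀ S : Finset (M → ℤ), S.card ≤ (r + r) ^ 4 → (∀ π ∈ S, π ≠ 0) →
      (∀ π ∈ S, ∀ μ, (π μ).natAbs ≤ 1) →
      ∃ w : M → ℕ, Good w ∧ (∀ μ, w μ < 2 ^ ℓ) ∧ ∀ π ∈ S, ∑ μ, π μ * (w μ : ℤ) ≠ 0)
    (hadm : ∃ σ : Equiv.Perm (Fin r), ∀ k, G₀ k (σ k)) :
    ∃ (T : ℕ) (ws : Fin T → M → ℕ), T ≤ Nat.log 2 r + 1 ∧ (∀ t, Good (ws t)) ∧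
      (∀ t μ, ws t μ < 2 ^ ℓ) ∧ ∃ σ : Equiv.Perm (Fin r), (∀ k, G₀ k (σ k)) ∧
        ∀ B : ℕ, r * 2 ^ ℓ ≤ 2 ^ B → ∀ τ : Equiv.Perm (Fin r), (∀ k, G₀ k (τ k)) → τ ≠ σ →
          ∑ k, ∑ t, (lab k (σ k)).elim 0 (ws t) * 2 ^ (B * (T - 1 - ↑t)) <
            ∑ k, ∑ t, (lab k (τ k)).elim 0 (ws t) * 2 ^ (B * (T - 1 - ↑t)) :=
  exists_isolating_rounds_of_mem
    (fun _ hGG₀ _ hg _ _ hc hl => labPat_walkSum_mem_famPatR_forest hlab hforest hGG₀ hg hc hl)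
    horacle hadm

end Summit.ValiantsHypothesis.ValiantsHypothesis.Theorems.IsolationRoundsForest
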